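import Literature.MathematicalPhysics.QuantumFieldTheory.Balaban1983to89.B3Op116SliceSums

/-!
# `Balaban1983to89.B3Op116FaceSumsBorderline` — T. Bałaban, *(Higgs)₂,₃ quantum fields in a finite volume. III. Renormalization*,
# Commun. Math. Phys. **88** (1983) 411–445 [Balaban1983Higgs3], (1.16) p. 414 / (2.6), (2.10) pp. 424–426 / p. 433:
# **THE BORDERLINE FACE CONVOLUTION (exponent ONE) WITH ITS EXPLICIT HEIGHT SUM** — a single layer on a face of a box read DIRECTLY through a
# differentiated column: in place of a geometric constant the height sum `W(h) = Σ_{i<k} e^{−(δ/2d)(L^iε)^{−1}ε·h}` appears (`≤ k` always; `O(1)` once the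
# height `h` of the anchor above the face is a top block) — the located logarithm of the (1.16)-on-a-box programme and its end-point margin

statement-level skeleton of published theorems with citation tags; proofs where landed; nothing here is a claim about the Yang–Mills mass gap

PDF held: `paper:balaban1983-higgs-2-3-quantum-fields-finite-volume` p. 414 [PDF 4], p. 424 [14], p. 426 [16], pp. 432–433 [22–23];
`paper:balaban1983-cmp89-regularity-decay` Sect. 5 p. 594.

CITATION HEADER (lean-in-tree rule).  T. Bałaban, CMP **88** (1983) 411–445 [Balaban1983Higgs3]: (1.16) p. 414, (2.5)/(2.6) p. 424, (2.10) p. 426,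
p. 433; T. Bałaban, CMP **89** (1983) 571–597 [Balaban1983RegularityDecay], Sect. 5 Theorem p. 594.  Cell `lit-balaban` (HOME
`run/shared/lean/pub/lit-balaban/`), Phase-2 proof seat **p35** gen 26 (literature-prover-lit-balaban-p35-g26-0; free-target protocol G.5-34(d), TAKING
HOME/STATUS.md 2026-08-23T12:38:30Z, cc p40 / p33 / r14 / r15).  SKELETON rows **B3.Eq1.16** / **B3.Eq2.5** / **B3.Txt@433** / **B3.Prop1** (owner r15) —
LOCATED ENGINE FILE, no head claim: file 3/3 of the face-sheet engine of the «(2.5) for (1.16) on a cell-product box without the support clause» programme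
(GAPS.md G-B3-16.A1; p35 `DESIGN-FILE4.md` §12(b)/§14; p40 `DESIGN-B3-116-box.md` §2b: *«Σ_{i<k} ≈ #{i : L^i ≳ dist(b₀,F)} = log_L(L^k/dist(b₀,F)) + O(1)»*).
Imports `B3Op116SliceSums` (`face_conv2_le` / `face_conv2_le'` WITH the height factor, `face_pair_scale_algebra`) and through it p33's
`B3Op116MajorantConvolution` (`sum_sq_le_lower_add_upper`, `sum_range_succ_mesh_rpow_le`), never restated.

WHAT IS PRINTED (verbatim).  p. 414 [PDF 4]: *"the Hölder norms of the covariant derivatives of this kernel … are … uniformly bounded by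
O(1)(e(L^kε)^{1−α})^{n+n′}"*; p. 433 [PDF 23]: *"We take a cube □₁ of size r(L^kε) containing the above cube in the center, and next we take a cube □ of
size 3r(L^kε) and with □₁ in the center"* — the localizations of the classes with an old vertex sit in `□₁`, a margin `r(L^kε) ≫ L^kε` away from `∂□`:
the margin under which the height sum below is `O(1)`.

WHAT THIS FILE PROVES (pure lattice-sum lemmas on `T_ε`; `F ⊆ {u : u_ν = c}`, anchor `b` at height `h = min{(b_ν − c) mod, (c − b_ν) mod}`).
* **`face_conv_majorant_one_le`** — for `s > 1`, `0 < δ ≤ 1`, `L > 1`: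
  `Σ_{u∈F} 𝔪(c₁,1;δ)(b,u)·𝔪(c₂,s;δ)(u,y) ≤ 𝔪(c₁c₂(8d/δ)^{d−1}(ε^{d−1})^{−1}·(W(h) + L^{s−1}(L^{s−1}−1)^{−1}), s; δ/2)(b,y)`,
  `W(h) := Σ_{i<k} e^{−(δ/(2d))(L^iε)^{−1}ε·h}`: the pairs of scales with the exponent-one factor the FINER gain no power of the finer scale, only the decay of
  the finer bump in the height (file 1 `face_conv2_le`) — whence `W` in place of a geometric constant; the other pairs are geometric (`s − 1 > 0`).
* `heightSum_le`: `W(h) ≤ k` (the trivial bound — logarithmic in `ε` at fixed `L^kε`).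
* **`heightSum_le_of_height`**: `h ≥ θ·L^k ⇒ W(h) ≤ r/(1 − r)`, `r = e^{−δθ(L−1)/(2d)}` — UNIFORM IN `k` (Bernoulli `L^{k−i} ≥ 1 + (k−i)(L−1)` and the
  reflected geometric sum): the END-POINT MARGIN of `DESIGN-FILE4.md` §14 (d) — a differentiated / Hölder end of the (1.16) kernel at least a top block
  away from `∂□`, as print's `□₁ ⊂ □` placement p. 433 provides.
* **`face_sum_kernel_one_margin_le`**: the kernel form of the two combined — a sheet `S ≤ 𝔪(c₂,s)` read directly through a differentiated column
  `K ≤ 𝔪(c₁,1)(b,·)` at an anchor of height `h ≥ θ·L^k`: `Σ_{u∈F}K(u)S(u) ≤ 𝔪(c₁c₂(8d/δ)^{d−1}(ε^{d−1})^{−1}(r/(1−r) + L^{s−1}(L^{s−1}−1)^{−1}), s; δ/2)(b,y)` —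
  what the hDv / hH binders of the box programme call at the end-point.
HONEST SCOPE.  As in files 1–2: no (1.16) object here; that the only non-composable sheet is the one read by the LAST differentiated end is the design claim
of `DESIGN-FILE4.md` §14, to be carried out in F2–F6 (not in the tree).  Theorems only: no `def`, no `def … : Prop`, no `sorry`; axioms standard.
-/

noncomputable section

open scoped BigOperators

namespace Literature.MathematicalPhysics.QuantumFieldTheory.Balaban1983to89.B3Op116FaceSumsBorderline

open B3Op116ScaleChains (rate_eq mesh_rpow_add)
open B3Op116MajorantConvolution (sum_sq_le_lower_add_upper sum_range_succ_mesh_rpow_le)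
open B3Op116SliceSums (face_conv2_le face_conv2_le' face_pair_scale_algebra)

variable {P : HiggsLattice.Params}

/-! ## §6 The borderline exponent ONE: the sheet read DIRECTLY through a differentiated column — the explicit height sum -/

section Borderline

/-- **THE BORDERLINE FACE CONVOLUTION** (exponent `a₁ = 1`, where §3 fails): for `s > 1`, `0 < δ ≤ 1`, `L > 1`, `F ⊆ {u_ν = c}` and an anchor `b`
at height `h = min{(b_ν − c) mod, (c − b_ν) mod}` above the slice,
`Σ_{u∈F} 𝔪(c₁,1;δ)(b,u)·𝔪(c₂,s;δ)(u,y) ≤ 𝔪(c₁c₂(8d/δ)^{d−1}(ε^{d−1})^{−1}·(W(h) + L^{s−1}(L^{s−1}−1)^{−1}), s; δ/2)(b,y)`,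
`W(h) := Σ_{i<k} e^{−(δ/(2d))(L^iε)^{−1}ε·h}` — the pairs (i ≤ j) (the exponent-one factor the finer) gain NO power of the finer scale, only the decay of
the finer bump in the height (§2 `face_conv2_le`), whence the height sum `W` in place of a geometric constant: `W ≤ k` always (`heightSum_le`), and
`W = O(1)` once `h ≳ L^k` (`heightSum_le_of_height`) — the logarithm `≈ log_L(L^k/h)` of a single layer read through a derivative kernel at height `h`
(p35 `DESIGN-FILE4.md` §12(b)/§14, p40 `DESIGN-B3-116-box.md` §2b), which is where the end-point margin of the (1.16)-on-a-box programme comes from.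
[cite: Balaban1983Higgs3, (1.16) p.414, (2.6) p.424, (2.10) p.426] [cite: Balaban1983RegularityDecay, Sect. 5 Theorem p.594] -/
theorem face_conv_majorant_one_le (hL : 1 < P.L) {k : ℕ} {δ : ℝ} (hδ : 0 < δ) (hδ1 : δ ≤ 1) {s c₁ c₂ : ℝ}
    (hs : 1 < s) (hc₁ : 0 ≤ c₁) (hc₂ : 0 ≤ c₂)
    {F : Finset (HiggsLattice.Site P 0)} {ν : Fin P.d} {c : ZMod (P.sitesPerDir 0 ν)} (hF : ∀ u ∈ F, u ν = c)
    (b y : HiggsLattice.Site P 0) :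
    ∑ u ∈ F,
        (∑ j ∈ Finset.range k, c₁ * P.mesh j ^ (1 - (P.d : ℝ)) *
            Real.exp (-(δ * (P.mesh j)⁻¹ * (P.mesh 0 * (HiggsLattice.Site.tdist b u : ℝ))))) *
        (∑ j ∈ Finset.range k, c₂ * P.mesh j ^ (s - (P.d : ℝ)) *
            Real.exp (-(δ * (P.mesh j)⁻¹ * (P.mesh 0 * (HiggsLattice.Site.tdist u y : ℝ)))))
      ≤ ∑ j ∈ Finset.range k, (c₁ * c₂ * ((8 * P.d / δ) ^ (P.d - 1) * (P.mesh 0 ^ (P.d - 1))⁻¹ *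
            ((∑ i ∈ Finset.range k, Real.exp (-(δ / (2 * P.d) * (P.mesh i)⁻¹ *
                (P.mesh 0 * ((min (b ν - c).val (c - b ν).val : ℕ) : ℝ)))))
              + (P.L : ℝ) ^ (s - 1) / ((P.L : ℝ) ^ (s - 1) - 1)))) *
          P.mesh j ^ (s - (P.d : ℝ)) *
          Real.exp (-(δ / 2 * (P.mesh j)⁻¹ * (P.mesh 0 * (HiggsLattice.Site.tdist b y : ℝ)))) := by
  have hL1 : (1 : ℝ) < (P.L : ℝ) := by exact_mod_cast hL
  have hL0 : (0 : ℝ) ≤ (P.L : ℝ) := Nat.cast_nonneg _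
  have hm : ∀ j, 0 < P.mesh j := P.mesh_pos
  have hs' : 0 < s - 1 := by linarith
  -- abbreviations
  set E : ℕ → HiggsLattice.Site P 0 → HiggsLattice.Site P 0 → ℝ :=
    fun j u v => Real.exp (-(δ * (P.mesh j)⁻¹ * (P.mesh 0 * (HiggsLattice.Site.tdist u v : ℝ)))) with hE
  set E2 : ℕ → ℝ := fun j => Real.exp (-(δ / 2 * (P.mesh j)⁻¹ * (P.mesh 0 * (HiggsLattice.Site.tdist b y : ℝ)))) with hE2
  have hE20 : ∀ j, 0 ≤ E2 j := fun j => Real.exp_nonneg _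
  set H : ℕ → ℝ := fun i => Real.exp (-(δ / (2 * P.d) * (P.mesh i)⁻¹ *
      (P.mesh 0 * ((min (b ν - c).val (c - b ν).val : ℕ) : ℝ)))) with hH
  have hH0 : ∀ i, 0 ≤ H i := fun i => Real.exp_nonneg _
  have hH1 : ∀ i, H i ≤ 1 := fun i => Real.exp_le_one_iff.mpr (by
    have : 0 ≤ δ / (2 * P.d) * (P.mesh i)⁻¹ * (P.mesh 0 * ((min (b ν - c).val (c - b ν).val : ℕ) : ℝ)) := by
      have := hm i; have := hm 0; positivity
    linarith)
  set W : ℝ := ∑ i ∈ Finset.range k, H i with hW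
  set K₀ : ℝ := (8 * P.d / δ) ^ (P.d - 1) with hK₀
  have hK₀0 : 0 ≤ K₀ := by rw [hK₀]; positivity
  set G₂ : ℝ := (P.L : ℝ) ^ (s - 1) / ((P.L : ℝ) ^ (s - 1) - 1) with hG₂
  have hG₂0 : 0 ≤ G₂ := by
    have := Real.one_lt_rpow hL1 hs'; rw [hG₂]; exact div_nonneg (by linarith) (by linarith)
  -- the height factor of a pair: the height decay of the FIRST bump when it is the finer one, else `1`
  set Hf : ℕ → ℕ → ℝ := fun j₁ j₂ => if j₁ ≤ j₂ then H j₁ else 1 with hHf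
  have hHf0 : ∀ j₁ j₂, 0 ≤ Hf j₁ j₂ := fun j₁ j₂ => by simp only [hHf]; split_ifs; exacts [hH0 _, zero_le_one]
  have hHf1 : ∀ j₁ j₂, Hf j₁ j₂ ≤ 1 := fun j₁ j₂ => by simp only [hHf]; split_ifs; exacts [hH1 _, le_rfl]
  -- the pair term after the face sum
  set g : ℕ → ℕ → ℝ := fun j₁ j₂ =>
    P.mesh j₁ ^ (1:ℝ) * P.mesh j₂ ^ s * (P.mesh (max j₁ j₂) ^ P.d)⁻¹ * (P.mesh (min j₁ j₂))⁻¹ * Hf j₁ j₂ * E2 (max j₁ j₂) with hg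
  have hg0 : ∀ j₁ j₂, 0 ≤ g j₁ j₂ := fun j₁ j₂ => by
    rw [hg]
    exact mul_nonneg (mul_nonneg (mul_nonneg (mul_nonneg (mul_nonneg (Real.rpow_nonneg (hm j₁).le _)
      (Real.rpow_nonneg (hm j₂).le _)) (inv_nonneg.mpr (pow_nonneg (hm _).le _))) (inv_nonneg.mpr (hm _).le)) (hHf0 _ _)) (hE20 _)
  -- Step 1: expand and bring the face sum inside
  have step1 : ∑ u ∈ F,
        (∑ j ∈ Finset.range k, c₁ * P.mesh j ^ (1 - (P.d : ℝ)) * E j b u) *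
        (∑ j ∈ Finset.range k, c₂ * P.mesh j ^ (s - (P.d : ℝ)) * E j u y)
      = ∑ j₁ ∈ Finset.range k, ∑ j₂ ∈ Finset.range k,
          c₁ * c₂ * (P.mesh j₁ ^ (1 - (P.d : ℝ)) * P.mesh j₂ ^ (s - (P.d : ℝ))) *
            ∑ u ∈ F, E j₁ b u * E j₂ u y := by
    calc ∑ u ∈ F,
          (∑ j ∈ Finset.range k, c₁ * P.mesh j ^ (1 - (P.d : ℝ)) * E j b u) *
          (∑ j ∈ Finset.range k, c₂ * P.mesh j ^ (s - (P.d : ℝ)) * E j u y)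
        = ∑ u ∈ F, ∑ j₁ ∈ Finset.range k, ∑ j₂ ∈ Finset.range k,
            c₁ * c₂ * (P.mesh j₁ ^ (1 - (P.d : ℝ)) * P.mesh j₂ ^ (s - (P.d : ℝ))) * (E j₁ b u * E j₂ u y) := by
          refine Finset.sum_congr rfl fun u _ => ?_
          rw [Finset.sum_mul_sum]
          refine Finset.sum_congr rfl fun j₁ _ => Finset.sum_congr rfl fun j₂ _ => ?_
          ring
      _ = ∑ j₁ ∈ Finset.range k, ∑ u ∈ F, ∑ j₂ ∈ Finset.range k,
            c₁ * c₂ * (P.mesh j₁ ^ (1 - (P.d : ℝ)) * P.mesh j₂ ^ (s - (P.d : ℝ))) * (E j₁ b u * E j₂ u y) :=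
          Finset.sum_comm
      _ = ∑ j₁ ∈ Finset.range k, ∑ j₂ ∈ Finset.range k, ∑ u ∈ F,
            c₁ * c₂ * (P.mesh j₁ ^ (1 - (P.d : ℝ)) * P.mesh j₂ ^ (s - (P.d : ℝ))) * (E j₁ b u * E j₂ u y) :=
          Finset.sum_congr rfl fun j₁ _ => Finset.sum_comm
      _ = _ := by
          refine Finset.sum_congr rfl fun j₁ _ => Finset.sum_congr rfl fun j₂ _ => ?_
          rw [Finset.mul_sum]
  -- Step 2: each pair of scales, keeping the height decay when the exponent-one bump is the finer one
  have step2 : ∀ j₁ j₂ : ℕ,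
      c₁ * c₂ * (P.mesh j₁ ^ (1 - (P.d : ℝ)) * P.mesh j₂ ^ (s - (P.d : ℝ))) * ∑ u ∈ F, E j₁ b u * E j₂ u y
        ≤ c₁ * c₂ * K₀ * (P.mesh 0 ^ (P.d - 1))⁻¹ * g j₁ j₂ := by
    intro j₁ j₂
    have hpre : 0 ≤ c₁ * c₂ * (P.mesh j₁ ^ (1 - (P.d : ℝ)) * P.mesh j₂ ^ (s - (P.d : ℝ))) :=
      mul_nonneg (mul_nonneg hc₁ hc₂) (mul_nonneg (Real.rpow_nonneg (hm j₁).le _) (Real.rpow_nonneg (hm j₂).le _))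
    -- the face sum with the height factor `Hf`
    have hconv : ∑ u ∈ F, E j₁ b u * E j₂ u y ≤ K₀ * ((P.L : ℝ) ^ (min j₁ j₂)) ^ (P.d - 1) * Hf j₁ j₂ * E2 (max j₁ j₂) := by
      by_cases hj : j₁ ≤ j₂
      · have h := face_conv2_le (P := P) hδ hδ1 hj hF b y
        have e1 : Hf j₁ j₂ = H j₁ := by simp only [hHf, if_pos hj]
        rw [min_eq_left hj, max_eq_right hj, e1]
        exact h
      · have hj' : j₂ ≤ j₁ := le_of_not_ge hj
        have h := face_conv2_le' (P := P) hδ hδ1 hj' hF b y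
        have e1 : Hf j₁ j₂ = 1 := by simp only [hHf, if_neg hj]
        rw [min_eq_right hj', max_eq_left hj', e1, mul_one]
        refine h.trans ?_
        have hC : 0 ≤ K₀ * ((P.L : ℝ) ^ j₂) ^ (P.d - 1) := by positivity
        have hHy : Real.exp (-(δ / (2 * P.d) * (P.mesh j₂)⁻¹ *
            (P.mesh 0 * ((min (y ν - c).val (c - y ν).val : ℕ) : ℝ)))) ≤ 1 :=
          Real.exp_le_one_iff.mpr (by
            have : 0 ≤ δ / (2 * P.d) * (P.mesh j₂)⁻¹ * (P.mesh 0 * ((min (y ν - c).val (c - y ν).val : ℕ) : ℝ)) := by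
              have := hm j₂; have := hm 0; positivity
            linarith)
        calc _ ≤ K₀ * ((P.L : ℝ) ^ j₂) ^ (P.d - 1) * 1 * E2 j₁ :=
              mul_le_mul_of_nonneg_right (mul_le_mul_of_nonneg_left hHy hC) (hE20 _)
          _ = _ := by rw [mul_one]
    calc c₁ * c₂ * (P.mesh j₁ ^ (1 - (P.d : ℝ)) * P.mesh j₂ ^ (s - (P.d : ℝ))) * ∑ u ∈ F, E j₁ b u * E j₂ u y
        ≤ c₁ * c₂ * (P.mesh j₁ ^ (1 - (P.d : ℝ)) * P.mesh j₂ ^ (s - (P.d : ℝ))) *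
            (K₀ * ((P.L : ℝ) ^ (min j₁ j₂)) ^ (P.d - 1) * Hf j₁ j₂ * E2 (max j₁ j₂)) := mul_le_mul_of_nonneg_left hconv hpre
      _ = c₁ * c₂ * K₀ * (P.mesh j₁ ^ (1 - (P.d : ℝ)) * P.mesh j₂ ^ (s - (P.d : ℝ)) * ((P.L : ℝ) ^ (min j₁ j₂)) ^ (P.d - 1)) *
            Hf j₁ j₂ * E2 (max j₁ j₂) := by ring
      _ = c₁ * c₂ * K₀ * (P.mesh j₁ ^ (1:ℝ) * P.mesh j₂ ^ s * (P.mesh (max j₁ j₂) ^ P.d)⁻¹ * (P.mesh (min j₁ j₂))⁻¹ *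
            (P.mesh 0 ^ (P.d - 1))⁻¹) * Hf j₁ j₂ * E2 (max j₁ j₂) := by rw [face_pair_scale_algebra]
      _ = c₁ * c₂ * K₀ * (P.mesh 0 ^ (P.d - 1))⁻¹ * g j₁ j₂ := by rw [hg]; ring
  -- Step 3: the lower triangle (`j₂ ≤ j₁`): the finer index carries `s − 1 > 0`; the height factor is dropped
  have step3 : ∀ j₁ : ℕ, ∑ j₂ ∈ Finset.range (j₁ + 1), g j₁ j₂ ≤ G₂ * (P.mesh j₁ ^ (s - (P.d : ℝ)) * E2 j₁) := by
    intro j₁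
    have hmax : ∀ j₂ ∈ Finset.range (j₁ + 1), g j₁ j₂
        ≤ P.mesh j₁ ^ (1:ℝ) * (P.mesh j₁ ^ P.d)⁻¹ * E2 j₁ * P.mesh j₂ ^ (s - 1) := by
      intro j₂ hj₂
      have h : max j₁ j₂ = j₁ := max_eq_left (by have := Finset.mem_range.1 hj₂; omega)
      have h' : min j₁ j₂ = j₂ := min_eq_right (by have := Finset.mem_range.1 hj₂; omega)
      have e : P.mesh j₁ ^ (1:ℝ) * P.mesh j₂ ^ s * (P.mesh j₁ ^ P.d)⁻¹ * (P.mesh j₂)⁻¹ * E2 j₁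
          = P.mesh j₁ ^ (1:ℝ) * (P.mesh j₁ ^ P.d)⁻¹ * E2 j₁ * P.mesh j₂ ^ (s - 1) := by
        rw [Real.rpow_sub_one (hm j₂).ne']; field_simp
      have hpre : 0 ≤ P.mesh j₁ ^ (1:ℝ) * P.mesh j₂ ^ s * (P.mesh j₁ ^ P.d)⁻¹ * (P.mesh j₂)⁻¹ :=
        mul_nonneg (mul_nonneg (mul_nonneg (Real.rpow_nonneg (hm j₁).le _) (Real.rpow_nonneg (hm j₂).le _))
          (inv_nonneg.mpr (pow_nonneg (hm _).le _))) (inv_nonneg.mpr (hm _).le)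
      rw [hg]; simp only [h, h']
      calc P.mesh j₁ ^ (1:ℝ) * P.mesh j₂ ^ s * (P.mesh j₁ ^ P.d)⁻¹ * (P.mesh j₂)⁻¹ * Hf j₁ j₂ * E2 j₁
          ≤ P.mesh j₁ ^ (1:ℝ) * P.mesh j₂ ^ s * (P.mesh j₁ ^ P.d)⁻¹ * (P.mesh j₂)⁻¹ * 1 * E2 j₁ :=
            mul_le_mul_of_nonneg_right (mul_le_mul_of_nonneg_left (hHf1 _ _) hpre) (hE20 _)
        _ = _ := by rw [mul_one, e]
    refine (Finset.sum_le_sum hmax).trans ?_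
    rw [← Finset.mul_sum]
    have hpre : 0 ≤ P.mesh j₁ ^ (1:ℝ) * (P.mesh j₁ ^ P.d)⁻¹ * E2 j₁ :=
      mul_nonneg (mul_nonneg (Real.rpow_nonneg (hm j₁).le _) (inv_nonneg.mpr (pow_nonneg (hm _).le _))) (hE20 _)
    calc P.mesh j₁ ^ (1:ℝ) * (P.mesh j₁ ^ P.d)⁻¹ * E2 j₁ * ∑ j₂ ∈ Finset.range (j₁ + 1), P.mesh j₂ ^ (s - 1)
        ≤ P.mesh j₁ ^ (1:ℝ) * (P.mesh j₁ ^ P.d)⁻¹ * E2 j₁ * (G₂ * P.mesh j₁ ^ (s - 1)) :=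
          mul_le_mul_of_nonneg_left (sum_range_succ_mesh_rpow_le hL hs' j₁) hpre
      _ = G₂ * ((P.mesh j₁ ^ (1:ℝ) * P.mesh j₁ ^ (s - 1) * (P.mesh j₁ ^ P.d)⁻¹) * E2 j₁) := by ring
      _ = G₂ * (P.mesh j₁ ^ (s - (P.d : ℝ)) * E2 j₁) := by
          rw [mesh_rpow_add, Real.rpow_sub (hm j₁), Real.rpow_natCast, div_eq_mul_inv]
          ring_nf
  -- Step 4: the upper triangle (`j₁ ≤ j₂ < k`): NO geometric gain — the height factors sum to `W`
  have step4 : ∀ j₂ ∈ Finset.range k, ∑ j₁ ∈ Finset.range (j₂ + 1), g j₁ j₂ ≤ W * (P.mesh j₂ ^ (s - (P.d : ℝ)) * E2 j₂) := by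
    intro j₂ hj₂
    have hk : j₂ + 1 ≤ k := Finset.mem_range.1 hj₂
    have hmax : ∀ j₁ ∈ Finset.range (j₂ + 1), g j₁ j₂ = P.mesh j₂ ^ (s - (P.d : ℝ)) * E2 j₂ * H j₁ := by
      intro j₁ hj₁
      have hle : j₁ ≤ j₂ := by have := Finset.mem_range.1 hj₁; omega
      have h : max j₁ j₂ = j₂ := max_eq_right hle
      have h' : min j₁ j₂ = j₁ := min_eq_left hle
      have e1 : Hf j₁ j₂ = H j₁ := by simp only [hHf, if_pos hle]
      rw [hg]; simp only [h, h']
      rw [e1, Real.rpow_one, Real.rpow_sub (hm j₂), Real.rpow_natCast, div_eq_mul_inv]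
      calc P.mesh j₁ * P.mesh j₂ ^ s * (P.mesh j₂ ^ P.d)⁻¹ * (P.mesh j₁)⁻¹ * H j₁ * E2 j₂
          = (P.mesh j₁ * (P.mesh j₁)⁻¹) * (P.mesh j₂ ^ s * (P.mesh j₂ ^ P.d)⁻¹ * E2 j₂ * H j₁) := by ring
        _ = P.mesh j₂ ^ s * (P.mesh j₂ ^ P.d)⁻¹ * E2 j₂ * H j₁ := by rw [mul_inv_cancel₀ (hm j₁).ne', one_mul]
    rw [Finset.sum_congr rfl hmax, ← Finset.mul_sum]
    have hpre : 0 ≤ P.mesh j₂ ^ (s - (P.d : ℝ)) * E2 j₂ := mul_nonneg (Real.rpow_nonneg (hm j₂).le _) (hE20 _)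
    have hsub : ∑ j₁ ∈ Finset.range (j₂ + 1), H j₁ ≤ W :=
      Finset.sum_le_sum_of_subset_of_nonneg
        (fun i hi => Finset.mem_range.mpr (lt_of_lt_of_le (Finset.mem_range.mp hi) hk)) (fun i _ _ => hH0 i)
    calc P.mesh j₂ ^ (s - (P.d : ℝ)) * E2 j₂ * ∑ j₁ ∈ Finset.range (j₂ + 1), H j₁
        ≤ P.mesh j₂ ^ (s - (P.d : ℝ)) * E2 j₂ * W := mul_le_mul_of_nonneg_left hsub hpre
      _ = _ := by ring
  -- Step 5: assemble
  have hpre : 0 ≤ c₁ * c₂ * K₀ * (P.mesh 0 ^ (P.d - 1))⁻¹ :=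
    mul_nonneg (mul_nonneg (mul_nonneg hc₁ hc₂) hK₀0) (inv_nonneg.mpr (pow_nonneg (hm 0).le _))
  calc ∑ u ∈ F,
        (∑ j ∈ Finset.range k, c₁ * P.mesh j ^ (1 - (P.d : ℝ)) * E j b u) *
        (∑ j ∈ Finset.range k, c₂ * P.mesh j ^ (s - (P.d : ℝ)) * E j u y)
      = _ := step1
    _ ≤ ∑ j₁ ∈ Finset.range k, ∑ j₂ ∈ Finset.range k, c₁ * c₂ * K₀ * (P.mesh 0 ^ (P.d - 1))⁻¹ * g j₁ j₂ :=
        Finset.sum_le_sum fun j₁ _ => Finset.sum_le_sum fun j₂ _ => step2 j₁ j₂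
    _ = c₁ * c₂ * K₀ * (P.mesh 0 ^ (P.d - 1))⁻¹ * ∑ j₁ ∈ Finset.range k, ∑ j₂ ∈ Finset.range k, g j₁ j₂ := by
        simp_rw [Finset.mul_sum]
    _ ≤ c₁ * c₂ * K₀ * (P.mesh 0 ^ (P.d - 1))⁻¹ *
          ((∑ j₁ ∈ Finset.range k, ∑ j₂ ∈ Finset.range (j₁ + 1), g j₁ j₂)
            + ∑ j₂ ∈ Finset.range k, ∑ j₁ ∈ Finset.range (j₂ + 1), g j₁ j₂) :=
        mul_le_mul_of_nonneg_left (sum_sq_le_lower_add_upper k g hg0) hpre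
    _ ≤ c₁ * c₂ * K₀ * (P.mesh 0 ^ (P.d - 1))⁻¹ *
          ((∑ j₁ ∈ Finset.range k, G₂ * (P.mesh j₁ ^ (s - (P.d : ℝ)) * E2 j₁))
            + ∑ j₂ ∈ Finset.range k, W * (P.mesh j₂ ^ (s - (P.d : ℝ)) * E2 j₂)) :=
        mul_le_mul_of_nonneg_left (add_le_add (Finset.sum_le_sum fun j₁ _ => step3 j₁)
          (Finset.sum_le_sum fun j₂ hj₂ => step4 j₂ hj₂)) hpre
    _ = ∑ j ∈ Finset.range k, (c₁ * c₂ * (K₀ * (P.mesh 0 ^ (P.d - 1))⁻¹ * (W + G₂))) *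
          P.mesh j ^ (s - (P.d : ℝ)) * E2 j := by
        rw [← Finset.sum_add_distrib, Finset.mul_sum]
        exact Finset.sum_congr rfl fun j _ => by ring
    _ = _ := by rw [hK₀, hW, hG₂]

/-- **The height sum is at most the number of scales**: `W(h) = Σ_{i<k} e^{−(δ/(2d))(L^iε)^{−1}ε·h} ≤ k` (every term `≤ 1`) — the trivial
bound, logarithmic in `ε` at fixed `L^kε`. [cite: Balaban1983Higgs3, (2.6) p.424] -/
theorem heightSum_le (k : ℕ) {δ h : ℝ} (hδ : 0 ≤ δ) (hh : 0 ≤ h) :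
    ∑ i ∈ Finset.range k, Real.exp (-(δ / (2 * P.d) * (P.mesh i)⁻¹ * (P.mesh 0 * h))) ≤ k := by
  have h1 : ∀ i ∈ Finset.range k, Real.exp (-(δ / (2 * P.d) * (P.mesh i)⁻¹ * (P.mesh 0 * h))) ≤ 1 := by
    intro i _
    apply Real.exp_le_one_iff.mpr
    have : 0 ≤ δ / (2 * P.d) * (P.mesh i)⁻¹ * (P.mesh 0 * h) := by
      have := P.mesh_pos i; have := P.mesh_pos 0; positivity
    linarith
  calc ∑ i ∈ Finset.range k, Real.exp (-(δ / (2 * P.d) * (P.mesh i)⁻¹ * (P.mesh 0 * h)))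
      ≤ ∑ _i ∈ Finset.range k, (1 : ℝ) := Finset.sum_le_sum h1
    _ = k := by simp

/-- **The height sum is `O(1)` at heights of one top block**: if `h ≥ θ·L^k` (lattice units; `θ > 0`, `L > 1`), then
`W(h) ≤ r/(1 − r)` with `r = e^{−δθ(L−1)/(2d)} < 1` — term `i` is `≤ e^{−(δθ/(2d))L^{k−i}} ≤ r^{k−i}` by Bernoulli `L^{k−i} ≥ 1 + (k−i)(L−1)`, and the
reflected geometric sum. UNIFORM IN `k` (hence in `ε`): the end-point margin of the box programme. [cite: Balaban1983Higgs3, (1.16) p.414, (2.6) p.424] -/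
theorem heightSum_le_of_height (hL : 1 < P.L) (k : ℕ) {δ θ h : ℝ} (hδ : 0 < δ) (hθ : 0 < θ)
    (hh : θ * (P.L : ℝ) ^ k ≤ h) :
    ∑ i ∈ Finset.range k, Real.exp (-(δ / (2 * P.d) * (P.mesh i)⁻¹ * (P.mesh 0 * h)))
      ≤ Real.exp (-(δ * θ * ((P.L : ℝ) - 1) / (2 * P.d))) / (1 - Real.exp (-(δ * θ * ((P.L : ℝ) - 1) / (2 * P.d)))) := by
  have hL1 : (1 : ℝ) < (P.L : ℝ) := by exact_mod_cast hL
  have hd0 : (0 : ℝ) < P.d := by exact_mod_cast P.hd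
  set a : ℝ := δ * θ * ((P.L : ℝ) - 1) / (2 * P.d) with ha
  have hLm1 : 0 < (P.L : ℝ) - 1 := by linarith
  have ha0 : 0 < a := by rw [ha]; exact div_pos (mul_pos (mul_pos hδ hθ) hLm1) (by positivity)
  set r : ℝ := Real.exp (-a) with hr
  have hr0 : 0 ≤ r := (Real.exp_pos _).le
  have hr1 : r < 1 := Real.exp_lt_one_iff.mpr (by linarith)
  -- each term is below `r^{k−i}`
  have hterm : ∀ i ∈ Finset.range k,
      Real.exp (-(δ / (2 * P.d) * (P.mesh i)⁻¹ * (P.mesh 0 * h))) ≤ r ^ (k - i) := by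
    intro i hi
    have hik : i ≤ k := (Finset.mem_range.1 hi).le
    rw [hr, ← Real.exp_nat_mul]
    apply Real.exp_le_exp.mpr
    rw [rate_eq]
    -- `h/L^i ≥ θ L^{k−i} ≥ θ (k−i)(L−1)`
    have hLi : (0 : ℝ) < (P.L : ℝ) ^ i := by positivity
    have hpow : (P.L : ℝ) ^ k = (P.L : ℝ) ^ (k - i) * (P.L : ℝ) ^ i := by
      rw [← pow_add, Nat.sub_add_cancel hik]
    have hbern : 1 + ((k - i : ℕ) : ℝ) * ((P.L : ℝ) - 1) ≤ (P.L : ℝ) ^ (k - i) := by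
      have := one_add_le_pow_of_two_add_nonneg (a := (P.L : ℝ) - 1) (by linarith) (k - i)
      simpa using this
    have h1 : θ * (((k - i : ℕ) : ℝ) * ((P.L : ℝ) - 1)) ≤ h / (P.L : ℝ) ^ i := by
      rw [le_div_iff₀ hLi]
      have : θ * (((k - i : ℕ) : ℝ) * ((P.L : ℝ) - 1)) * (P.L : ℝ) ^ i ≤ θ * (P.L : ℝ) ^ (k - i) * (P.L : ℝ) ^ i := by
        apply mul_le_mul_of_nonneg_right _ hLi.le
        apply mul_le_mul_of_nonneg_left _ hθ.le
        linarith
      rw [hpow] at hh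
      linarith
    have h2 : ((k - i : ℕ) : ℝ) * a ≤ δ / (2 * P.d) / (P.L : ℝ) ^ i * h := by
      rw [ha]
      have e : ((k - i : ℕ) : ℝ) * (δ * θ * ((P.L : ℝ) - 1) / (2 * P.d))
          = δ / (2 * P.d) * (θ * (((k - i : ℕ) : ℝ) * ((P.L : ℝ) - 1))) := by ring
      rw [e, show δ / (2 * P.d) / (P.L : ℝ) ^ i * h = δ / (2 * P.d) * (h / (P.L : ℝ) ^ i) by ring]
      exact mul_le_mul_of_nonneg_left h1 (by positivity)
    linarith
  -- the reflected geometric sum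
  have hrefl : ∑ i ∈ Finset.range k, r ^ (k - i) = r * ∑ j ∈ Finset.range k, r ^ j := by
    rw [← Finset.sum_range_reflect (fun i => r ^ (k - i)) k, Finset.mul_sum]
    refine Finset.sum_congr rfl fun j hj => ?_
    have : k - (k - 1 - j) = j + 1 := by have := Finset.mem_range.1 hj; omega
    rw [this, pow_succ]; ring
  calc ∑ i ∈ Finset.range k, Real.exp (-(δ / (2 * P.d) * (P.mesh i)⁻¹ * (P.mesh 0 * h)))
      ≤ ∑ i ∈ Finset.range k, r ^ (k - i) := Finset.sum_le_sum hterm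
    _ = r * ∑ j ∈ Finset.range k, r ^ j := hrefl
    _ ≤ r / (1 - r) := by
        have hg := geom_sum_Ico_le_of_lt_one (m := 0) (n := k) hr0 hr1
        rw [← Finset.range_eq_Ico, pow_zero] at hg
        rw [div_eq_mul_one_div]
        exact mul_le_mul_of_nonneg_left hg hr0

/-- **THE END-POINT FORM WITH THE MARGIN**: a single layer `S ≤ 𝔪(c₂,s;δ)(·,y)` on a face `F ⊆ {u_ν = c}` read DIRECTLY through a differentiated
column `K ≤ 𝔪(c₁,1;δ)(b,·)` anchored at a point `b` whose height above the face is at least a top block, `h ≥ θ·L^k` (`θ > 0`; print's `□₁ ⊂ □`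
placement p. 433 gives `h ≥ r(L^kε)/(L^kε)·L^k ≫ L^k`): `Σ_{u∈F} K(u)S(u) ≤ 𝔪(c₁c₂(8d/δ)^{d−1}(ε^{d−1})^{−1}(r/(1−r) + L^{s−1}(L^{s−1}−1)^{−1}), s; δ/2)(b,y)`,
`r = e^{−δθ(L−1)/(2d)}` — UNIFORM IN `k`: the hDv / hH binders of (2.5) for (1.16) on a box at ends one top block inside `□` (`DESIGN-FILE4.md` §14 (d)).
[cite: Balaban1983Higgs3, (1.16) p.414, (2.5) p.424, (2.10) p.426, p.433] -/
theorem face_sum_kernel_one_margin_le (hL : 1 < P.L) {k : ℕ} {δ : ℝ} (hδ : 0 < δ) (hδ1 : δ ≤ 1) {s c₁ c₂ θ : ℝ}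
    (hs : 1 < s) (hc₁ : 0 ≤ c₁) (hc₂ : 0 ≤ c₂) (hθ : 0 < θ)
    {F : Finset (HiggsLattice.Site P 0)} {ν : Fin P.d} {c : ZMod (P.sitesPerDir 0 ν)} (hF : ∀ u ∈ F, u ν = c)
    (b y : HiggsLattice.Site P 0) (hh : θ * (P.L : ℝ) ^ k ≤ ((min (b ν - c).val (c - b ν).val : ℕ) : ℝ))
    (K S : HiggsLattice.Site P 0 → ℝ) (hK0 : ∀ u ∈ F, 0 ≤ K u) (hS0 : ∀ u ∈ F, 0 ≤ S u)
    (hK : ∀ u ∈ F, K u ≤ ∑ j ∈ Finset.range k, c₁ * P.mesh j ^ (1 - (P.d : ℝ)) *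
      Real.exp (-(δ * (P.mesh j)⁻¹ * (P.mesh 0 * (HiggsLattice.Site.tdist b u : ℝ)))))
    (hS : ∀ u ∈ F, S u ≤ ∑ j ∈ Finset.range k, c₂ * P.mesh j ^ (s - (P.d : ℝ)) *
      Real.exp (-(δ * (P.mesh j)⁻¹ * (P.mesh 0 * (HiggsLattice.Site.tdist u y : ℝ))))) :
    ∑ u ∈ F, K u * S u
      ≤ ∑ j ∈ Finset.range k, (c₁ * c₂ * ((8 * P.d / δ) ^ (P.d - 1) * (P.mesh 0 ^ (P.d - 1))⁻¹ *
            (Real.exp (-(δ * θ * ((P.L : ℝ) - 1) / (2 * P.d))) / (1 - Real.exp (-(δ * θ * ((P.L : ℝ) - 1) / (2 * P.d))))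
              + (P.L : ℝ) ^ (s - 1) / ((P.L : ℝ) ^ (s - 1) - 1)))) *
          P.mesh j ^ (s - (P.d : ℝ)) *
          Real.exp (-(δ / 2 * (P.mesh j)⁻¹ * (P.mesh 0 * (HiggsLattice.Site.tdist b y : ℝ)))) := by
  -- kernel form of the borderline lemma
  have h1 := face_conv_majorant_one_le (P := P) hL (k := k) hδ hδ1 hs hc₁ hc₂ hF b y
  have h0 : ∑ u ∈ F, K u * S u ≤ ∑ u ∈ F,
      (∑ j ∈ Finset.range k, c₁ * P.mesh j ^ (1 - (P.d : ℝ)) *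
          Real.exp (-(δ * (P.mesh j)⁻¹ * (P.mesh 0 * (HiggsLattice.Site.tdist b u : ℝ))))) *
      (∑ j ∈ Finset.range k, c₂ * P.mesh j ^ (s - (P.d : ℝ)) *
          Real.exp (-(δ * (P.mesh j)⁻¹ * (P.mesh 0 * (HiggsLattice.Site.tdist u y : ℝ))))) :=
    Finset.sum_le_sum fun u hu => mul_le_mul (hK u hu) (hS u hu) (hS0 u hu) ((hK0 u hu).trans (hK u hu))
  -- the height sum under the margin
  have hW := heightSum_le_of_height (P := P) hL k hδ hθ hh
  refine h0.trans (h1.trans (Finset.sum_le_sum fun j _ => ?_))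
  have hm : ∀ j, 0 < P.mesh j := P.mesh_pos
  have hpost : 0 ≤ P.mesh j ^ (s - (P.d : ℝ)) *
      Real.exp (-(δ / 2 * (P.mesh j)⁻¹ * (P.mesh 0 * (HiggsLattice.Site.tdist b y : ℝ)))) :=
    mul_nonneg (Real.rpow_nonneg (hm j).le _) (Real.exp_nonneg _)
  have key : c₁ * c₂ * ((8 * P.d / δ) ^ (P.d - 1) * (P.mesh 0 ^ (P.d - 1))⁻¹ *
        ((∑ i ∈ Finset.range k, Real.exp (-(δ / (2 * P.d) * (P.mesh i)⁻¹ *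
            (P.mesh 0 * ((min (b ν - c).val (c - b ν).val : ℕ) : ℝ)))))
          + (P.L : ℝ) ^ (s - 1) / ((P.L : ℝ) ^ (s - 1) - 1)))
      ≤ c₁ * c₂ * ((8 * P.d / δ) ^ (P.d - 1) * (P.mesh 0 ^ (P.d - 1))⁻¹ *
        (Real.exp (-(δ * θ * ((P.L : ℝ) - 1) / (2 * P.d))) / (1 - Real.exp (-(δ * θ * ((P.L : ℝ) - 1) / (2 * P.d))))
          + (P.L : ℝ) ^ (s - 1) / ((P.L : ℝ) ^ (s - 1) - 1))) := by
    have hA : 0 ≤ (8 * P.d / δ) ^ (P.d - 1) * (P.mesh 0 ^ (P.d - 1))⁻¹ := by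
      have := inv_nonneg.mpr (pow_nonneg (hm 0).le (P.d - 1)); positivity
    exact mul_le_mul_of_nonneg_left (mul_le_mul_of_nonneg_left (add_le_add hW le_rfl) hA) (mul_nonneg hc₁ hc₂)
  calc _ = c₁ * c₂ * ((8 * P.d / δ) ^ (P.d - 1) * (P.mesh 0 ^ (P.d - 1))⁻¹ *
        ((∑ i ∈ Finset.range k, Real.exp (-(δ / (2 * P.d) * (P.mesh i)⁻¹ *
            (P.mesh 0 * ((min (b ν - c).val (c - b ν).val : ℕ) : ℝ)))))
          + (P.L : ℝ) ^ (s - 1) / ((P.L : ℝ) ^ (s - 1) - 1))) *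
        (P.mesh j ^ (s - (P.d : ℝ)) * Real.exp (-(δ / 2 * (P.mesh j)⁻¹ * (P.mesh 0 * (HiggsLattice.Site.tdist b y : ℝ))))) := by ring
    _ ≤ c₁ * c₂ * ((8 * P.d / δ) ^ (P.d - 1) * (P.mesh 0 ^ (P.d - 1))⁻¹ *
        (Real.exp (-(δ * θ * ((P.L : ℝ) - 1) / (2 * P.d))) / (1 - Real.exp (-(δ * θ * ((P.L : ℝ) - 1) / (2 * P.d))))
          + (P.L : ℝ) ^ (s - 1) / ((P.L : ℝ) ^ (s - 1) - 1))) *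
        (P.mesh j ^ (s - (P.d : ℝ)) * Real.exp (-(δ / 2 * (P.mesh j)⁻¹ * (P.mesh 0 * (HiggsLattice.Site.tdist b y : ℝ))))) :=
        mul_le_mul_of_nonneg_right key hpost
    _ = _ := by ring

end Borderline

end Literature.MathematicalPhysics.QuantumFieldTheory.Balaban1983to89.B3Op116FaceSumsBorderline

end
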